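import Literature.MathematicalPhysics.QuantumFieldTheory.Balaban1983to89.B8Thm2TorusServerP
import Literature.MathematicalPhysics.QuantumFieldTheory.Balaban1983to89.B8SockHFPTorusTraceFreePer

/-!
# `Balaban1983to89.B8Thm2TorusServerPer` — [Balaban1985RegularSpaces] Prop. 5 (p. 94) on `T_η`, v3 (RULING #4: the [4] letters' laws at
# `P`-PERIODIC ARGUMENTS ONLY): route P's Proposition-5 EXISTENCE sockets `SockP5Base`, `SockP5Step` of `B8Thm2TorusSupplier.Thm2TorusSockets … G`
# for ONE periodic `G`-valued background, SERVED FROM THE v3 LETTERS `LettersAtPer`; plus the torus-index bookkeeping of the uniqueness storey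
# (locality of `Q′(U₀)ᵀ`, the level-periodic representative of a Landau multiplier) (sub-row «G-B8-T2S», layer 3(h) of
# `lit-balaban-t2s-1/g2/V3-DESIGN.md`)

statement-level skeleton of published theorems with citation tags; proofs where landed; nothing here is a claim about the
Yang–Mills mass gap

T. Bałaban, *Spaces of regular gauge field configurations on a lattice and gauge fixing conditions*, Commun. Math. Phys. **99** (1985) 75–102
`[Balaban1985RegularSpaces]` ("B8"): Prop. 5 (1.106)–(1.109) p. 94, Thm 4 p. 88, p. 89 (base of the induction), p. 77 («Ω_j = T_η»), p. 76
(`G = SU(N)`), §3 p. 98.  T. Bałaban, *Propagators for lattice gauge theories in a background field*, Commun. Math. Phys. **99** (1985) 389–434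
`[Balaban1985BackgroundPropagators]` ("[4]"): (3.19) p. 393, (3.24) p. 394.  STATUS: published, refereed.

CITATION HEADER (lean-in-tree rule).  Cell `lit-balaban`, seat `lit-balaban-t2s-1` (gen 3), sub-row «G-B8-T2S» (R3 `stmt-QuantumFields-19200`,
`--supports`, helper), route P on the v3 letters.  WHY.  The v2 servers `B8Thm2TorusServerP ∕ P2 ∕ P3` obtained the `P`-PERIODICITY of the
Proposition-5 gauge `v = e^{iλ}` from print's «exactly one λ» (the translate of a solution is a solution).  On the v3 letters the Proposition-5
contraction is run on the closed subspace of `P`-periodic configurations (`B8Prop5ContractionKLevelPer`; the periodic ∃λ-bodies of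
`B8SockHFPTorusTraceFreePer`, p607197), so `λ` is periodic BY CONSTRUCTION and the existence sockets need no «exactly one ⇒ periodic» detour
(lead g30 ACK 2026-08-28T06:35Z).  WHAT IS PROVED (0 sorry, no `def`):
* §0 bookkeeping for the torus index: `QprimeT_congr_iterate` (LOCALITY of [4] (3.19)ᵀ: `(Q′_jᵀν)(x)` reads `ν` at the level-`j` block ancestor
  of `x` only), `QprimeT_indicator_perz` ∕ ★ `QT_perzFam_eq` (`Q′(U₀)ᵀ(πμ)(x) = Q′(U₀)ᵀμ(x mod P)` for a periodic background, `Lʲ ∣ P`,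
  shift-invariant constraint sets, `π` = the level-wise periodisation `B8TorusPeriodization.perzFam`), ★ `exists_levelPeriodic_multiplier` (a
  `P`-periodic function of the form `Q′(U₀)ᵀμ` is `Q′(U₀)ᵀμ̃` for a LEVEL-PERIODIC `μ̃` — the representative that the v3 uniqueness engine
  `B8Prop5UniqKLevelBPer` asks of a competitor's Landau multiplier);
* §1 ★ `sockP5Step_body_per`, `sockP5Base_body_per` — `B8Thm2TorusServerP.sockP5Step_body_of_traceFree ∕ sockP5Base_body_of_traceFree` with the
  ∃λ-body carrying «`λ` is `P`-periodic» and WITHOUT the «exactly one» hypothesis `huniq`: the ∃-clauses of `SockP5Step … G U₀ U′ m` ∕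
  `SockP5Base … G U₀ U′` (`v := e^{iλ}` is `G`-valued by the J-SU law `hG3`, periodic because `λ` is);
* §2 ★ `sockP5Step_of_lettersAtPer`, ★ `sockP5Base_of_lettersAtPer` — `B8Thm2TorusSupplier.SockP5Step L P η c⋆ α₄ G U₀ U′ m` (every `1 ≤ m < k`)
  and `SockP5Base L P η α₄ G U₀ U′` at `c⋆ = 5dLB₀(α₀ + α₁)`, `α₄ = 8B₀′·5dLB₀·(α₀ + α₁)` FROM THE v3 LETTERS `ℓ : LettersAtPer … k α₀ P U₀` with
  `LettersPerTau τ ℓ`, the b9 socket at every truncation, the J-SU group data and the JOIN windows at `B_R + 2`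
  (`B8SockHFPTorusTraceFreePer.sockHFPτ_family_of_lettersAtPer ∕ sockHFP₀τ_family_of_lettersAtPer` at the periodised exponent `π A` of the datum —
  the datum `U₁ = U′^{u₁⁻¹}` is periodic, so `e^{iηA} = e^{iη·πA}` bondwise — then §1).

## HONEST SCOPE
(i) Compositions of landed theorems; Proposition 5 is NOT re-proved; the v3 letters `LettersAtPer` (sub-row «G-B9-LETTERS», no supplier in tree),
the b9 socket `SockB9P3` and the J-SU group data are displayed hypotheses; windows explicit and merely sufficient (threshold
`B8SockHFPWindows.hfpWindows_of_guard` at `B_R + 2`).  (ii) `d ≥ 2`, `L ≥ 2`, `G ≤ U(𝔸)` averaging-closed inside `H`, `𝔸` a C⋆-algebra, `P ∈ Lᵏℤ`,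
`U₀`, `U′` periodic.  Count-neutral; N05 ∕ `stub_PV3A` NOT discharged; Theorem 2 not claimed here; nothing continuum ∕ ℝ⁴ ∕ OS ∕ mass-gap ∕
Clay — the Yang–Mills mass gap is NOT proved.  No `sorry`, no `def`, no `… : Prop` fact, no `instance`, no `notation`.
-/

noncomputable section

open NormedSpace
open scoped BigOperators

namespace Literature.MathematicalPhysics.QuantumFieldTheory.Balaban1983to89.B8Thm2TorusServerPer

open Complex (I)
open MatrixLog (mlog)
open Literature.MathematicalPhysics.QuantumLattice (blockMap)
open B7Prop1Explicit B7Prop2Explicit B7Prop1Local B7Eq92Concrete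
open B7Prop2Explicit (C0 c2')
open B7Prop3Flat (c3)
open B7Prop10General (C6 C4G)
open B7Prop10Flat (one_le_C5)
open B7Prop9Flat (C5')
open B7Eq78Linearization (conjR)
open B8Ineq132 (covDerivFwd covDeriv InAk)
open B8Eq119TwistedAxial (Restr129 InAx bgT)
open B8Eq184Proof (gaugeExp cfgExp)
open B8Eq182Proof (gAd)
open B8Eq188Proof (frakF3)
open B8Lemma1NonAbelian (mulCfg)
open B8Eq140Level (SideTouches)
open B8Eq138LandauZd (IsLandau138 IsLandau138W covLap covDivB qprimeT1 QprimeT QT logCfg)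
open B8Prop5KLevelLetters (isLandau138W_gaugeFixed_of_multiplier)
open B8Ineq125Concrete (C2p)
open B8LeafModelZd3 (SockB9P3)
open B8Prop5ContractionKLevel (Mc Kc)
open B12Ineq417Flat (shiftCfg shiftCfg_apply)
open B8Thm4TorusAt (torusLam mem_torusLam_iff)
open B8Thm2TorusMember (torusLamb)
open B8Thm2TorusSupplier (SockP5Step SockP5Base sideTouches_univ)
open B8TorusShiftLandau (QprimeT_shiftCfg)
open B8TorusPeriodization (pmod pmod_apply perz perz_apply perz_per perzFam perzFam_apply_of_le perzFam_per apply_add_sum_of_per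
  apply_pmod_of_per)
open B8Thm2TorusLetters (torus_member_laws)
open B8Thm2TorusLettersPer (LettersAtPer LettersPerTau)
open B8SockHFPTorusTraceFreePer (sockHFPτ_family_of_lettersAtPer sockHFP₀τ_family_of_lettersAtPer)

-- `Site` alone could resolve to the torus sites of `Setup.lean`; re-export the `ℤ^d` sites of `B7Prop1Explicit`.
export B7Prop1Explicit (Site)

variable {d : ℕ}

/-! ## §0 Bookkeeping for the torus index: lattice vectors, block ancestors, locality of `Q′ᵀ`, the level-periodic representative -/

section Lattice

/-- `Σ_i c_i • e_i = c` on `ℤᵈ`. [cite: Balaban1985RegularSpaces, (1.3) p.77] -/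
theorem sum_smul_e (c : Site d) : ∑ i : Fin d, (c i) • (e i : Site d) = c := by
  funext j
  simp only [Finset.sum_apply, Pi.smul_apply, e, Pi.single_apply, smul_eq_mul, mul_ite, mul_one, mul_zero,
    Finset.sum_ite_eq, Finset.mem_univ, if_true]

/-- A `P`-periodic site function is invariant under the lattice translation `x ↦ x + (n_i P)_i`. [cite: Balaban1985RegularSpaces, p.77 («Ω_j = T_η»)] -/
theorem apply_add_mul_of_per {β : Type*} {P : ℤ} {f : Site d → β} (hf : ∀ (z : Site d) (i : Fin d), f (z + P • e i) = f z)
    (x n : Site d) : f (x + fun i => n i * P) = f x := by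
  have h := apply_add_sum_of_per hf x n Finset.univ
  have h2 : (∑ i : Fin d, (n i * P) • (e i : Site d)) = fun i => n i * P := sum_smul_e (fun i => n i * P)
  rw [h2] at h
  exact h

/-- `j` block maps of side `L` compose to the block map of side `Lʲ` (`⌊⌊x/L⌋/L⌋ = ⌊x/L²⌋`, …; the `ℤᵈ` twin of
`B9B8AveragingJunction.blockMap_iterate`). [cite: Balaban1985Averaging, (43) p.24 («k-th order averaging»)] -/
theorem blockMap_iterate_eq (L j : ℕ) (x : Site d) : (blockMap L)^[j] x = blockMap (L ^ j) x := by
  induction j generalizing x with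
  | zero => funext μ; simp [blockMap]
  | succ j ih =>
      rw [Function.iterate_succ, Function.comp_apply, ih, B7BlockGeometry.blockMap_blockMap, pow_succ']

end Lattice

section Locality

variable {𝔸 : Type*} [CStarAlgebra 𝔸]

/-- **LOCALITY OF `Q′_j(U₀)ᵀ`** ([4] (3.19) transposed): `(Q′_j(U₀)ᵀν)(x)` reads `ν` at the level-`j` block ancestor `⌊x/Lʲ⌋` of `x` only — two
level-`j` functions that agree there have the same transpose average at `x`. [cite: Balaban1985BackgroundPropagators, (3.19) p.393, (3.24) p.394] -/
theorem QprimeT_congr_iterate (L : ℕ) (U₀ : Site d → Fin d → 𝔸ˣ) :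
    ∀ (j : ℕ) (ν ν' : Site d → 𝔸) (x : Site d), ν ((blockMap L)^[j] x) = ν' ((blockMap L)^[j] x) →
      QprimeT L U₀ j ν x = QprimeT L U₀ j ν' x
  | 0, ν, ν', x, h => by simpa [QprimeT] using h
  | j + 1, ν, ν', x, h => by
      show QprimeT L U₀ j (qprimeT1 L U₀ j ν) x = QprimeT L U₀ j (qprimeT1 L U₀ j ν') x
      refine QprimeT_congr_iterate L U₀ j _ _ x ?_
      simp only [qprimeT1]
      rw [← Function.iterate_succ_apply' (blockMap L) j x, h]

/-- **`Q′_j(U₀)ᵀ` OF A PERIODISED LEVEL-`j` MULTIPLIER** (periodic background `U₀`, `Lʲ ∣ P`, a `(P∕Lʲ)`-invariant constraint set `Λ`):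
`Q′_jᵀ(1_Λ·(μ ∘ (· mod P∕Lʲ)))(x) = Q′_jᵀ(1_Λ·μ)(x mod P)` — translation covariance of (3.19)ᵀ (`B8TorusShiftLandau.QprimeT_shiftCfg`) by the
lattice vector `x mod P − x ∈ Lʲ·(P∕Lʲ)ℤᵈ`, then locality at the block ancestor, where `⌊x/Lʲ⌋ mod (P∕Lʲ) = ⌊x/Lʲ⌋ + (x mod P − x)∕Lʲ`.
[cite: Balaban1985BackgroundPropagators, (3.19) p.393, (3.24) p.394; Balaban1985RegularSpaces, (1.3)–(1.6) p.77 («Ω_j = T_η»)] -/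
theorem QprimeT_indicator_perz {L : ℕ} (hL : 1 ≤ L) {P : ℤ} {j : ℕ} (hdiv : ((L : ℤ) ^ j ∣ P)) {Λ : Set (Site d)}
    (hΛ : ∀ (y : Site d) (i : Fin d), y + (P / (L : ℤ) ^ j) • e i ∈ Λ ↔ y ∈ Λ)
    {U₀ : Site d → Fin d → 𝔸ˣ} (hU₀ : ∀ (z : Site d) (i : Fin d), U₀ (z + P • e i) = U₀ z) (ν : Site d → 𝔸) (x : Site d) :
    QprimeT L U₀ j (Λ.indicator (perz (P / (L : ℤ) ^ j) ν)) x = QprimeT L U₀ j (Λ.indicator ν) (pmod P x) := by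
  set Q : ℤ := P / (L : ℤ) ^ j with hQ
  have hPQ : P = (L : ℤ) ^ j * Q := (Int.mul_ediv_cancel' hdiv).symm
  have hLj0 : (0 : ℤ) ≤ (L : ℤ) ^ j := by positivity
  set n : Site d := fun i => -(x i / P) with hn
  set w : Site d := fun i => n i * Q with hw
  have hLw : ((L : ℤ) ^ j) • w = fun i => n i * P := by
    funext i
    simp only [Pi.smul_apply, smul_eq_mul, hw]
    rw [hPQ]; ring
  have hpm : pmod P x = x + ((L : ℤ) ^ j) • w := by
    rw [hLw]
    funext i
    simp only [pmod_apply, Pi.add_apply, hn]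
    rw [Int.emod_def]; ring
  have hU : shiftCfg (((L : ℤ) ^ j) • w) U₀ = U₀ := by
    funext z
    rw [shiftCfg_apply, hLw, apply_add_mul_of_per hU₀]
  rw [hpm, ← QprimeT_shiftCfg hL U₀ j w (Λ.indicator ν) x, hU]
  refine QprimeT_congr_iterate L U₀ j _ _ x ?_
  rw [shiftCfg_apply, blockMap_iterate_eq]
  have hy : pmod Q (blockMap (L ^ j) x) = blockMap (L ^ j) x + w := by
    funext i
    simp only [pmod_apply, B7BlockGeometry.blockMap_apply, Pi.add_apply, hw, hn, Nat.cast_pow]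
    rw [Int.emod_def, Int.ediv_ediv_of_nonneg hLj0, ← hPQ]; ring
  have hmem : blockMap (L ^ j) x + w ∈ Λ ↔ blockMap (L ^ j) x ∈ Λ := by
    have h := apply_add_mul_of_per (f := fun y : Site d => y ∈ Λ) (P := Q) (fun z i => propext (hΛ z i)) (blockMap (L ^ j) x) n
    exact Iff.of_eq h
  by_cases hx : blockMap (L ^ j) x ∈ Λ
  · rw [Set.indicator_of_mem hx, Set.indicator_of_mem (hmem.2 hx), perz_apply, hy]
  · rw [Set.indicator_of_notMem hx, Set.indicator_of_notMem (fun h => hx (hmem.1 h))]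

/-- ★ **`Q′(U₀)ᵀ` OF THE LEVEL-WISE PERIODISED MULTIPLIER FAMILY**: for a `P`-periodic background, `Lʲ ∣ P` and `(P∕Lʲ)`-invariant constraint sets
`Λ_j` (`j ≤ k`): `Q′(U₀)ᵀ(π μ)(x) = Q′(U₀)ᵀμ (x mod P)`, `π = B8TorusPeriodization.perzFam L P k` (level `j` reduced modulo `P∕Lʲ`).
[cite: Balaban1985BackgroundPropagators, (3.24) p.394; Balaban1985RegularSpaces, (1.29) p.81, (1.3)–(1.6) p.77] -/
theorem QT_perzFam_eq {L : ℕ} (hL : 1 ≤ L) (k : ℕ) {P : ℤ} (hdiv : ∀ j, j ≤ k → ((L : ℤ) ^ j ∣ P)) {Λs : ℕ → Set (Site d)}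
    (hΛ : ∀ j, j ≤ k → ∀ (y : Site d) (i : Fin d), y + (P / (L : ℤ) ^ j) • e i ∈ Λs j ↔ y ∈ Λs j)
    {U₀ : Site d → Fin d → 𝔸ˣ} (hU₀ : ∀ (z : Site d) (i : Fin d), U₀ (z + P • e i) = U₀ z) (μ : ℕ → Site d → 𝔸) (x : Site d) :
    QT L k Λs U₀ (perzFam L P k μ) x = QT L k Λs U₀ μ (pmod P x) := by
  unfold QT
  refine Finset.sum_congr rfl fun j hj => ?_
  have hjk : j ≤ k := Nat.lt_succ_iff.1 (Finset.mem_range.1 hj)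
  have hpz : perzFam L P k μ j = perz (P / (L : ℤ) ^ j) (μ j) := funext fun y => perzFam_apply_of_le L P μ hjk y
  rw [hpz]
  exact QprimeT_indicator_perz hL (hdiv j hjk) (hΛ j hjk) hU₀ (μ j) x

/-- ★ **A LEVEL-PERIODIC REPRESENTATIVE OF A LANDAU MULTIPLIER ON THE TORUS**: if a `P`-periodic site function `F` equals `Q′(U₀)ᵀμ` everywhere
(the multiplier form of (1.38) at `Ω₀ = ℤᵈ`, `B8Eq138LandauZd.IsLandau138`), then `F = Q′(U₀)ᵀμ̃` for the LEVEL-PERIODIC family `μ̃ = π μ`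
(`μ̃_j(y + (P∕Lʲ)eᵢ) = μ̃_j(y)`, `j ≤ k`) — the shape in which the v3 uniqueness engine `B8Prop5UniqKLevelBPer` reads a competitor's Landau letter.
[cite: Balaban1985RegularSpaces, (1.38) p.82, (1.29) p.81, p.77 («Ω_j = T_η»); Balaban1985BackgroundPropagators, (3.24)–(3.25) p.394] -/
theorem exists_levelPeriodic_multiplier {L : ℕ} (hL : 1 ≤ L) (k : ℕ) {P : ℤ} (hdiv : ∀ j, j ≤ k → ((L : ℤ) ^ j ∣ P))
    {Λs : ℕ → Set (Site d)} (hΛ : ∀ j, j ≤ k → ∀ (y : Site d) (i : Fin d), y + (P / (L : ℤ) ^ j) • e i ∈ Λs j ↔ y ∈ Λs j)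
    {U₀ : Site d → Fin d → 𝔸ˣ} (hU₀ : ∀ (z : Site d) (i : Fin d), U₀ (z + P • e i) = U₀ z)
    {F : Site d → 𝔸} (hF : ∀ (z : Site d) (i : Fin d), F (z + P • e i) = F z) {μ : ℕ → Site d → 𝔸}
    (h : ∀ x, F x = QT L k Λs U₀ μ x) :
    ∃ μ' : ℕ → Site d → 𝔸, (∀ j, j ≤ k → ∀ (y : Site d) (i : Fin d), μ' j (y + (P / (L : ℤ) ^ j) • e i) = μ' j y) ∧
      ∀ x, F x = QT L k Λs U₀ μ' x :=
  ⟨perzFam L P k μ, perzFam_per L P k μ, fun x => by rw [QT_perzFam_eq hL k hdiv hΛ hU₀, ← h, apply_pmod_of_per hF]⟩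

/-- The exponent `λ` read through `e^{iλ}` pointwise: `e^{iλ}` of a `P`-periodic `λ` is `P`-periodic. [cite: Balaban1985RegularSpaces, Prop. 5 (1.107) p.94, p.77] -/
theorem gaugeExp_per {P : ℤ} {lam : Site d → 𝔸} (h : ∀ (z : Site d) (i : Fin d), lam (z + P • e i) = lam z) :
    ∀ (x : Site d) (i : Fin d), gaugeExp lam (x + P • e i) = gaugeExp lam x := fun x i => by
  unfold gaugeExp; rw [h x i]

/-- A periodic configuration read through a periodised exponent: if `U₁` is `P`-periodic and `U₁ = e^{iηA}` bondwise with `A` Hermitian and bounded,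
then the same holds for the `P`-PERIODIC exponent `π A = A ∘ (· mod P)`. [cite: Balaban1985RegularSpaces, (1.69) p.88, (1.36) p.82, p.77 («Ω_j = T_η»)] -/
theorem datum_perz {η : ℝ} {P : ℤ} {U₁ : Site d → Fin d → 𝔸ˣ} (hU₁P : ∀ (x : Site d) (i : Fin d), U₁ (x + P • e i) = U₁ x)
    {A : Site d → Fin d → 𝔸} {c : ℝ}
    (hdat : ∀ (x : Site d) (κ : Fin d), U₁ x κ = cfgExp η A x κ ∧ IsSelfAdjoint (A x κ) ∧ ‖A x κ‖ ≤ c) :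
    ∀ (x : Site d) (κ : Fin d), U₁ x κ = cfgExp η (perz P A) x κ ∧ IsSelfAdjoint (perz P A x κ) ∧ ‖perz P A x κ‖ ≤ c := by
  intro x κ
  obtain ⟨h1, h2, h3⟩ := hdat (pmod P x) κ
  refine ⟨?_, h2, h3⟩
  calc U₁ x κ = U₁ (pmod P x) κ := by rw [apply_pmod_of_per hU₁P]
    _ = cfgExp η A (pmod P x) κ := h1
    _ = cfgExp η (perz P A) x κ := rfl

/-- The level-`m` datum `U₁ = U′^{u₁⁻¹}` of periodic data is periodic (`U₁(b) = u₁(b₋)⁻¹U′(b)R(U₀(b))u₁(b₊)` from `U₁^{u₁} = U′`).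
[cite: Balaban1985RegularSpaces, (1.17) p.78, (1.68) p.88, p.77] -/
theorem datum_per {P : ℤ} {U₀ U' U₁ : Site d → Fin d → 𝔸ˣ} {u₁ : Site d → 𝔸ˣ} (hW : mgauge U₀ u₁ U₁ = U')
    (hU₀P : ∀ (x : Site d) (i : Fin d), U₀ (x + P • e i) = U₀ x) (hU'P : ∀ (x : Site d) (i : Fin d), U' (x + P • e i) = U' x)
    (hu₁P : ∀ (x : Site d) (i : Fin d), u₁ (x + P • e i) = u₁ x) :
    ∀ (x : Site d) (i : Fin d), U₁ (x + P • e i) = U₁ x := by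
  intro x i
  have key : ∀ y κ, U₁ y κ = (u₁ y)⁻¹ * U' y κ * Rc (U₀ y κ) (u₁ (y + e κ)) := fun y κ => by
    have h := congrFun (congrFun hW y) κ
    rw [mgauge_apply] at h
    rw [← h]; group
  funext κ
  rw [key, key, hu₁P, hU'P, hU₀P, add_right_comm, hu₁P]

end Locality

/-! ## §1 The Proposition-5 step ∕ base ∃-clauses from a PERIODIC `τ`-free ∃λ-body (no «exactly one» input) -/

section Adapter

variable {𝔸 : Type*} [CStarAlgebra 𝔸] [Nontrivial 𝔸]

/-- ★ **THE PROPOSITION-5 STEP SOCKET OF ROUTE P FROM THE PERIODIC `τ`-FREE ∃λ-BODY, FOR ONE DATUM** (p. 94 on `T_η`, v3):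
`B8Thm2TorusServerP.sockP5Step_body_of_traceFree` with the ∃λ-body of the v3 storey (`B8SockHFPTorusTraceFreePer`: `λ` Hermitian, `τ`-free, (1.108) at
`α₄`, the multiplier clause, (1.29) for `u₁e^{iλ}`, AND `λ` `P`-PERIODIC — the contraction ran on the closed subspace of periodic configurations) and
WITHOUT the «exactly one» hypothesis: `v := e^{iλ}` is `G`-valued by the J-SU law `hG3`, `P`-periodic because `λ` is, and `U₁^{v⁻¹}` is Landau at
`m + 1` levels by `B8Prop5KLevelLetters.isLandau138W_gaugeFixed_of_multiplier` (windows `α₄ ≤ 1/84`, `c⋆ ≤ 1/12`).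
[cite: Balaban1985RegularSpaces, Prop. 5 (1.106)–(1.108) p.94, Thm 4 p.88, p.77 («Ω_j = T_η»), p.76, §3 p.98] -/
theorem sockP5Step_body_per (hd2 : 2 ≤ d) {η : ℝ} (hη : 0 < η) {L : ℕ} (hL : 1 ≤ L) (m : ℕ) {P : ℤ}
    (τ : 𝔸 →L[ℂ] ℂ) {G : Subgroup 𝔸ˣ} (hG3 : ∀ (lam : Site d → 𝔸) (x : Site d), IsSelfAdjoint (lam x) → τ (lam x) = 0 → gaugeExp lam x ∈ G)
    {U₀ U₁ : Site d → Fin d → 𝔸ˣ} (hU₀ : ∀ x κ, U₀ x κ ∈ unitaryUnits 𝔸) {u₁ : Site d → 𝔸ˣ}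
    {A : Site d → Fin d → 𝔸} {cstar α₄ : ℝ} (hs₁ : α₄ ≤ 1 / 84) (hcs : cstar ≤ 1 / 12)
    (hdat : ∀ (x : Site d) (κ : Fin d), U₁ x κ = cfgExp η A x κ ∧ IsSelfAdjoint (A x κ) ∧ ‖A x κ‖ ≤ cstar * ((L : ℝ) ^ m * η)⁻¹)
    (hbody : ∃ lam : Site d → 𝔸, (∀ (z : Site d) (i : Fin d), lam (z + P • e i) = lam z) ∧
      (∀ x, IsSelfAdjoint (lam x)) ∧ (∀ x, x ∉ (Set.univ : Set (Site d)) → lam x = 0) ∧ (∀ x, τ (lam x) = 0) ∧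
      (∀ j, j ≤ m + 1 → ∀ b ∈ {b : Site d × Fin d | SideTouches (Set.univ : Set (Site d)) b.1 b.2},
        ‖lam b.1‖ ≤ α₄ ∧ ((L : ℝ) ^ j * η) * ‖covDerivFwd η U₀ b.2 lam b.1‖ ≤ α₄) ∧
      (∃ μ : ℕ → Site d → 𝔸, ∀ x ∈ (Set.univ : Set (Site d)),
        covLap η U₀ ((Set.univ : Set (Site d)).indicator fun y => covDivB η U₀ A y + covLap η U₀ lam y +
          ((conjR (gaugeExp lam y)⁻¹ (covDivB η U₀ A y) - covDivB η U₀ A y) +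
            (gAd (covLap η U₀ lam y) (lam y) - covLap η U₀ lam y) + ∑ μ, frakF3 η U₀ lam A y μ)) x =
          QT L (m + 1) (torusLam (m + 1)) U₀ μ x) ∧
      Restr129 L (m + 1) (torusLam (m + 1)) U₀ (u₁ * gaugeExp lam)) :
    ∃ (v : Site d → 𝔸ˣ) (lam : Site d → 𝔸), (∀ x, v x ∈ G) ∧ (∀ (x : Site d) (i : Fin d), v (x + P • e i) = v x) ∧
      (∀ x, ((v x : 𝔸ˣ) : 𝔸) = ((gaugeExp lam x : 𝔸ˣ) : 𝔸)) ∧ (∀ x, ‖lam x‖ ≤ α₄) ∧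
      (∀ (x : Site d) (κ : Fin d), ((L : ℝ) ^ (m + 1) * η) * ‖covDerivFwd η U₀ κ lam x‖ ≤ α₄) ∧
      IsLandau138W L (m + 1) η (Set.univ : Set (Site d)) (torusLam (m + 1)) U₀ (mgauge U₀ v⁻¹ U₁) ∧
      Restr129 L (m + 1) (torusLam (m + 1)) U₀ (u₁ * v) := by
  obtain ⟨lam, hlamP, hsa, -, hτ0, h108, hmult, h129⟩ := hbody
  have hST : ∀ (y : Site d) (κ : Fin d), (y, κ) ∈ {b : Site d × Fin d | SideTouches (Set.univ : Set (Site d)) b.1 b.2} :=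
    fun y κ => sideTouches_univ hd2 y κ
  have hα12 : α₄ ≤ 1 / 12 := hs₁.trans (by norm_num)
  have hα70 : α₄ ≤ 1 / 70 := hs₁.trans (by norm_num)
  have hd1 : 0 < d := by omega
  have hLr : (1 : ℝ) ≤ L := by exact_mod_cast hL
  -- (1.108) at level `0` and at level `m + 1`, everywhere (every bond touches `T_η`)
  have h0 : ∀ (y : Site d) (κ : Fin d), ‖lam y‖ ≤ α₄ ∧ η * ‖covDerivFwd η U₀ κ lam y‖ ≤ α₄ := fun y κ => by
    simpa only [pow_zero, one_mul] using h108 0 (Nat.zero_le _) (y, κ) (hST y κ)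
  have htop : ∀ (y : Site d) (κ : Fin d), ((L : ℝ) ^ (m + 1) * η) * ‖covDerivFwd η U₀ κ lam y‖ ≤ α₄ := fun y κ =>
    (h108 (m + 1) le_rfl (y, κ) (hST y κ)).2
  -- the Landau condition of `e^{iηA}` gauge-fixed by `e^{−iλ}` from the multiplier form
  have hl : ∀ x ∈ (Set.univ : Set (Site d)), ‖lam x‖ ≤ 1 / 12 := fun x _ => (h0 x ⟨0, hd1⟩).1.trans hα12
  have hD : ∀ x ∈ (Set.univ : Set (Site d)), ∀ μ, η * ‖covDerivFwd η U₀ μ lam x‖ ≤ 1 / 70 := fun x _ μ => (h0 x μ).2.trans hα70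
  have ha : ∀ x ∈ (Set.univ : Set (Site d)), ∀ μ, η * ‖covDeriv η U₀ μ lam x‖ ≤ 1 / 70 := fun x _ μ => by
    rw [B8Eq151V2Divergence.norm_covDeriv_eq (unitaryUnits_le_U1 (hU₀ _ _)) lam]
    exact (h0 _ μ).2.trans hα70
  have hY : ∀ x ∈ (Set.univ : Set (Site d)), ∀ μ, η * ‖conjR (U₀ (x - e μ) μ)⁻¹ (A (x - e μ) μ)‖ ≤ 1 / 12 := fun x _ μ => by
    obtain ⟨-, -, hA⟩ := hdat (x - e μ) μ
    rw [B8Ineq132.norm_conjR ((U1 𝔸).inv_mem (unitaryUnits_le_U1 (hU₀ _ _)))]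
    have hLm : (1 : ℝ) ≤ (L : ℝ) ^ m := one_le_pow₀ hLr
    have hcs0 : 0 ≤ cstar := by
      have h := (norm_nonneg _).trans hA
      have hpos : (0 : ℝ) < ((L : ℝ) ^ m * η)⁻¹ := by positivity
      nlinarith
    have hA' : ‖A (x - e μ) μ‖ ≤ cstar * η⁻¹ := by
      refine hA.trans (mul_le_mul_of_nonneg_left ?_ hcs0)
      rw [mul_inv]
      calc ((L : ℝ) ^ m)⁻¹ * η⁻¹ ≤ 1 * η⁻¹ := mul_le_mul_of_nonneg_right (inv_le_one_of_one_le₀ hLm) (by positivity)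
        _ = η⁻¹ := one_mul _
    calc η * ‖A (x - e μ) μ‖ ≤ η * (cstar * η⁻¹) := mul_le_mul_of_nonneg_left hA' hη.le
      _ = cstar := by rw [mul_left_comm, mul_inv_cancel₀ hη.ne', mul_one]
      _ ≤ 1 / 12 := hcs
  have hLanA : IsLandau138W L (m + 1) η (Set.univ : Set (Site d)) (torusLam (m + 1)) U₀ (mgauge U₀ (gaugeExp lam)⁻¹ (cfgExp η A)) :=
    isLandau138W_gaugeFixed_of_multiplier hη L (m + 1) (Set.univ : Set (Site d)) (torusLam (m + 1)) U₀ A hl hD ha hY hmult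
  have hU₁A : U₁ = cfgExp η A := funext fun x => funext fun κ => (hdat x κ).1
  have hLan : IsLandau138W L (m + 1) η (Set.univ : Set (Site d)) (torusLam (m + 1)) U₀ (mgauge U₀ (gaugeExp lam)⁻¹ U₁) := by
    rw [hU₁A]; exact hLanA
  exact ⟨gaugeExp lam, lam, fun x => hG3 lam x (hsa x) (hτ0 x), gaugeExp_per hlamP, fun x => rfl, fun x => (h0 x ⟨0, hd1⟩).1, htop,
    hLan, h129⟩

/-- ★ **THE PROPOSITION-5 BASE SOCKET OF ROUTE P FROM THE PERIODIC `τ`-FREE ∃λ-BODY** (p. 89 «for k = 0 … u₁ = 1, U₁ = U′»; p. 94; v3):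
`sockP5Step_body_per` at `m = 0`, `u₁ = 1`, `U₁ = U′` — the ∃-clause of `B8Thm2TorusSupplier.SockP5Base … G U₀ U′` (a `G`-valued `P`-periodic
`v = e^{iλ}` with (1.108), `U′^{v⁻¹}` Landau at one level, (1.29) for `v` at one level), no «exactly one» input.
[cite: Balaban1985RegularSpaces, Prop. 5 (1.106)–(1.108) p.94, p.89 (the start of the induction), p.77, §3 p.98] -/
theorem sockP5Base_body_per (hd2 : 2 ≤ d) {η : ℝ} (hη : 0 < η) {L : ℕ} (hL : 1 ≤ L) {P : ℤ}
    (τ : 𝔸 →L[ℂ] ℂ) {G : Subgroup 𝔸ˣ} (hG3 : ∀ (lam : Site d → 𝔸) (x : Site d), IsSelfAdjoint (lam x) → τ (lam x) = 0 → gaugeExp lam x ∈ G)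
    {U₀ U' : Site d → Fin d → 𝔸ˣ} (hU₀ : ∀ x κ, U₀ x κ ∈ unitaryUnits 𝔸)
    {A : Site d → Fin d → 𝔸} {cstar α₄ : ℝ} (hs₁ : α₄ ≤ 1 / 84) (hcs : cstar ≤ 1 / 12)
    (hdat : ∀ (x : Site d) (κ : Fin d), U' x κ = cfgExp η A x κ ∧ IsSelfAdjoint (A x κ) ∧ ‖A x κ‖ ≤ cstar * ((L : ℝ) ^ 0 * η)⁻¹)
    (hbody : ∃ lam : Site d → 𝔸, (∀ (z : Site d) (i : Fin d), lam (z + P • e i) = lam z) ∧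
      (∀ x, IsSelfAdjoint (lam x)) ∧ (∀ x, x ∉ (Set.univ : Set (Site d)) → lam x = 0) ∧ (∀ x, τ (lam x) = 0) ∧
      (∀ j, j ≤ 1 → ∀ b ∈ {b : Site d × Fin d | SideTouches (Set.univ : Set (Site d)) b.1 b.2},
        ‖lam b.1‖ ≤ α₄ ∧ ((L : ℝ) ^ j * η) * ‖covDerivFwd η U₀ b.2 lam b.1‖ ≤ α₄) ∧
      (∃ μ : ℕ → Site d → 𝔸, ∀ x ∈ (Set.univ : Set (Site d)),
        covLap η U₀ ((Set.univ : Set (Site d)).indicator fun y => covDivB η U₀ A y + covLap η U₀ lam y +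
          ((conjR (gaugeExp lam y)⁻¹ (covDivB η U₀ A y) - covDivB η U₀ A y) +
            (gAd (covLap η U₀ lam y) (lam y) - covLap η U₀ lam y) + ∑ μ, frakF3 η U₀ lam A y μ)) x =
          QT L 1 (torusLam 1) U₀ μ x) ∧
      Restr129 L 1 (torusLam 1) U₀ ((1 : Site d → 𝔸ˣ) * gaugeExp lam)) :
    ∃ (v : Site d → 𝔸ˣ) (lam : Site d → 𝔸), (∀ x, v x ∈ G) ∧ (∀ (x : Site d) (i : Fin d), v (x + P • e i) = v x) ∧
      (∀ x, ((v x : 𝔸ˣ) : 𝔸) = ((gaugeExp lam x : 𝔸ˣ) : 𝔸)) ∧ (∀ x, ‖lam x‖ ≤ α₄) ∧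
      (∀ (x : Site d) (κ : Fin d), ((L : ℝ) ^ 1 * η) * ‖covDerivFwd η U₀ κ lam x‖ ≤ α₄) ∧
      IsLandau138W L 1 η (Set.univ : Set (Site d)) (torusLam 1) U₀ (mgauge U₀ v⁻¹ U') ∧ Restr129 L 1 (torusLam 1) U₀ v := by
  obtain ⟨v, lam, hG, hper, hv, hl, hD, hLan, h129⟩ := sockP5Step_body_per hd2 hη hL 0 (P := P) τ hG3 hU₀ (u₁ := 1) hs₁ hcs hdat hbody
  refine ⟨v, lam, hG, hper, hv, hl, ?_, hLan, ?_⟩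
  · simpa only [zero_add] using hD
  · simpa only [one_mul, zero_add] using h129

end Adapter

/-! ## §2 Route P's Proposition-5 STEP and BASE sockets from the v3 letters `LettersAtPer` -/

section Step

variable {𝔸 : Type*} [CStarAlgebra 𝔸] [Nontrivial 𝔸]
variable (τ : 𝔸 →L[ℂ] ℂ)

/-- ★ **ROUTE P's PROPOSITION-5 STEP SOCKET AT EVERY LEVEL `1 ≤ m < k`, FROM THE v3 LETTERS** (p. 94 on `T_η`; RULING #4):
`B8Thm2TorusSupplier.SockP5Step L P η c⋆ α₄ G U₀ U′ m` at `c⋆ = 5dLB₀(α₀ + α₁)`, `α₄ = 8B₀′·5dLB₀·(α₀ + α₁)` for a `G`-valued `P`-periodic pair in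
Theorem 4's regime on `T_η` ((1.33), (1.34), all-truncations axial, the all-levels closeness `≤ α₁`), GIVEN: the v3 [4] letters `ℓ : LettersAtPer …
k α₀ P U₀` (identity laws at periodic arguments) with the `τ`-laws `LettersPerTau τ ℓ`, the b9 socket at every truncation, the J-SU group data
(`G ≤ H`, (H2)∕(H3) for `τ`, `AvgClosed G`, `G ≤ U(𝔸)`, `hG3`), `P = Lᵏ·M`, and the JOIN windows of `B8SockHFPWindows.hfpWindows_of_guard` read
at `B_R + 2`.  PROOF: the datum `U₁ = U′^{u₁⁻¹}` is periodic (`datum_per`), its exponent is periodised (`datum_perz`, same bondwise readings), the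
v3 ∃λ-body `B8SockHFPTorusTraceFreePer.sockHFPτ_family_of_lettersAtPer` gives a PERIODIC `τ`-free `λ`, and `sockP5Step_body_per` concludes.
[cite: Balaban1985RegularSpaces, Prop. 5 (1.106)–(1.108) p.94, Thm 4 p.88, (1.68)–(1.69) p.88, p.77, p.76, §3 p.98] -/
theorem sockP5Step_of_lettersAtPer (hτ : ∀ x y : 𝔸, τ (x * y) = τ (y * x)) (hd2 : 2 ≤ d) {L : ℕ} (hL : 2 ≤ L) {η : ℝ} (hη : 0 < η)
    {k : ℕ} {G H : Subgroup 𝔸ˣ} (hGrp2 : ∀ g ∈ H, ‖(g : 𝔸) - 1‖ ≤ 1 / 8 → τ (mlog (g : 𝔸)) = 0) (hGrp3 : ∀ S : 𝔸, τ S = 0 → expUnit S ∈ H)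
    (hGA : AvgClosed d L G) (hGH : G ≤ H) (hGu : G ≤ unitaryUnits 𝔸)
    (hG3 : ∀ (lam : Site d → 𝔸) (x : Site d), IsSelfAdjoint (lam x) → τ (lam x) = 0 → gaugeExp lam x ∈ G)
    {α₀ α₁ B₀ B₀' B₀'H B₂' BG BR B₀β cB9 cB β : ℝ} {len : Site d → ℝ} (hα₀ : 0 < α₀) (hα₁ : 0 < α₁)
    (hB₀ : 0 < B₀) (hB₀' : 0 < B₀') (hB₀'H : 0 < B₀'H) (hB₂' : 0 ≤ B₂') (hBG : 0 ≤ BG) (hBR : 0 ≤ BR)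
    {U₀ U' : Site d → Fin d → 𝔸ˣ} (hU₀G : ∀ x κ, U₀ x κ ∈ G) (hU'G : ∀ x κ, U' x κ ∈ G)
    (h33 : InAk L k η α₀ (fun _ => (Set.univ : Set (Site d))) U₀) (h34 : InAk L k η α₀ (fun _ => (Set.univ : Set (Site d))) (mulCfg U' U₀))
    (hAx : ∀ m', m' ≤ k → InAx L m' (torusLam (d := d) m') U₀ (mulCfg U' U₀))
    (h135 : ∀ j, j ≤ k → ∀ (z : Site d) (μ : Fin d), (∀ x, InBox (loK L j z) (bondHiK L j z μ) x → x ∈ (fun _ => (Set.univ : Set (Site d))) j) →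
      ‖(avgIter L (mulCfg U' U₀) j z μ : 𝔸) - (avgIter L U₀ j z μ : 𝔸)‖ ≤ α₁)
    -- the torus: the period `P = Lᵏ·M`, the pair periodic, the v3 [4] letters and their `τ`-add-on, the b9 socket at every truncation
    {P : ℤ} (hPdiv : ∃ M : ℤ, P = (L : ℤ) ^ k * M) (hU₀per : ∀ (z : Site d) (i : Fin d), U₀ (z + P • e i) = U₀ z)
    (hU'per : ∀ (z : Site d) (i : Fin d), U' (z + P • e i) = U' z)
    (ℓ : LettersAtPer (𝔸 := 𝔸) L BG BR B₀'H B₂' B₀ B₀β cB β len η k α₀ P U₀) (ℓτ : LettersPerTau (𝔸 := 𝔸) τ ℓ)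
    (SB9all : ∀ m, m ≤ k → SockB9P3 (𝔸 := 𝔸) L B₀ B₀β cB9 β len η m (fun _ => (Set.univ : Set (Site d)))
      (fun m => torusLam (d := d) m) (fun m => torusLamb (d := d) m))
    (hwin : ∀ cs α₄ cB cDA hE hE₂ lE lE₂ : ℝ, cs = 5 * (d : ℝ) * L * B₀ * (α₀ + α₁) → α₄ = 8 * B₀' * (5 * (d : ℝ) * L * B₀) * (α₀ + α₁) →
      cB = L * cs → cDA = 2 * (d : ℝ) * (L : ℝ) ^ 2 * cs →
      hE = B₀'H * (C2p d * (40 * d * cB + α₄) * α₄) → hE₂ = B₂' * (C2p d * (40 * d * cB + α₄) * α₄) →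
      lE = B₀'H * (4 * C2p d * (40 * d * cB + 2 * α₄)) → lE₂ = B₂' * (4 * C2p d * (40 * d * cB + 2 * α₄)) →
      36 * d * B₀ * cs ≤ 1 / 2 ∧
      8 * (131072 * ((d : ℝ) + 1) ^ 2) * Real.exp (4 * (800 * ((d : ℝ) + 1) ^ 2 * ((d : ℝ) + 4)) * α₀) ≤ 16 * (131072 * ((d : ℝ) + 1) ^ 2) ∧
      2 * cs ^ 2 + 20 * d * α₀ * cs + 2 * (16 * (131072 * ((d : ℝ) + 1) ^ 2)) * cs ^ 2 ≤ α₀ + α₁ ∧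
      (d : ℝ) * L * α₁ ≤ 1 / 8 ∧
      α₀ ≤ cB9 ∧ cs ≤ cB9 ∧
      C0 d * α₀ ≤ 1 / 3 ∧ 4 * α₀ ≤ c2' d L ∧
      Real.exp (4 * (800 * ((d : ℝ) + 1) ^ 2 * ((d : ℝ) + 4)) * α₀) * (1 + 8 * (131072 * ((d : ℝ) + 1) ^ 2) * cB) ≤ 2 ∧
      2 * cB ≤ c3 d L ∧ 2048 * (d : ℝ) * cB ≤ 1 ∧ 40 * d * cB ≤ 1 / 200 ∧
      200 * C6 d * (2 * α₄) ≤ 1 ∧ 12000 * ((d : ℝ) + 1) * L * (2 * α₄) ≤ 1 ∧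
      C4G d L * (α₀ + 40 * d * cB + 4 * (2 * α₄)) ≤ 1 ∧
      1024 * ((d : ℝ) + 1) * ((d : ℝ) + 4) * L ^ 2 * α₀ ≤ 1 ∧ 32 * ((d : ℝ) + 1) ^ 2 * C6 d * L ^ 2 * α₀ ≤ 1 ∧
      16 * d * C5' d * C6 d * (L : ℝ) ^ 2 * α₀ ≤ 1 ∧ 8 * d * C6 d * L * α₀ ≤ 1 ∧
      40 * d * cB + α₄ ≤ 1 / (4 * B₀'H * (2 * C2p d)) ∧ 2 * C6 d * (40 * d * cB + 4 * α₄) ≤ 1 / 8 ∧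
      cB ≤ 1 / 13 ∧ α₄ / 4 + hE ≤ 1 / 24 ∧ α₄ / 4 + hE ≤ 1 / 140 ∧ 10 * (α₄ / 4 + hE) * (BR + 2) ≤ 1 / 2 ∧
      BG * Mc d (BR + 2) (α₄ / 4 + hE) cB hE₂ cDA ≤ α₄ / 4 ∧
      BG * Kc d (BR + 2) (α₄ / 4 + hE) cB hE₂ cDA lE₂ (1 + lE) (1 + lE) ≤ 1 / 2) :
    ∀ m, 1 ≤ m → m < k →
      SockP5Step (𝔸 := 𝔸) L P η (5 * (d : ℝ) * L * B₀ * (α₀ + α₁)) (8 * B₀' * (5 * (d : ℝ) * L * B₀) * (α₀ + α₁)) G U₀ U' m := by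
  intro m hm1 hmk u₁ U₁ A hu₁G hu₁P hW h129 hLan hdat
  have hL1 : 1 ≤ L := le_trans (by norm_num) hL
  have hLr : (1 : ℝ) ≤ L := by exact_mod_cast hL1
  have hU₀ : ∀ x κ, U₀ x κ ∈ unitaryUnits 𝔸 := fun x κ => hGu (hU₀G x κ)
  -- two of the windows: `α₄ ≤ 1/84` and `c⋆ ≤ 1/12`
  obtain ⟨-, -, -, -, -, -, -, -, -, -, -, hα₃', hs₁, -⟩ := hwin _ _ _ _ _ _ _ _ rfl rfl rfl rfl rfl rfl rfl rfl
  have hsum : 0 ≤ α₀ + α₁ := by linarith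
  have hcs0 : 0 ≤ 5 * (d : ℝ) * L * B₀ * (α₀ + α₁) := by positivity
  have hC6 : (2 : ℝ) ≤ C6 d := by unfold C6; linarith [one_le_C5 (d := d)]
  have hα84 : 8 * B₀' * (5 * (d : ℝ) * L * B₀) * (α₀ + α₁) ≤ 1 / 84 := by
    have h0 : 0 ≤ 8 * B₀' * (5 * (d : ℝ) * L * B₀) * (α₀ + α₁) := by positivity
    nlinarith [hs₁, hC6, h0]
  have hcs12 : 5 * (d : ℝ) * L * B₀ * (α₀ + α₁) ≤ 1 / 12 := by
    have hd0 : (1 : ℝ) ≤ d := by exact_mod_cast (show 1 ≤ d by omega)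
    have hcsB : 5 * (d : ℝ) * L * B₀ * (α₀ + α₁) ≤ L * (5 * (d : ℝ) * L * B₀ * (α₀ + α₁)) := le_mul_of_one_le_left hcs0 hLr
    have hcBsmall : (d : ℝ) * (L * (5 * (d : ℝ) * L * B₀ * (α₀ + α₁))) ≤ 1 / 8000 := by linarith only [hα₃']
    have h1 : 5 * (d : ℝ) * L * B₀ * (α₀ + α₁) ≤ 1 / 8000 :=
      ((le_mul_of_one_le_left hcs0 hd0).trans (mul_le_mul_of_nonneg_left hcsB (by positivity))).trans hcBsmall
    linarith only [h1]
  -- the datum is periodic; read it through the periodised exponent `π A`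
  have hU₁P : ∀ (x : Site d) (i : Fin d), U₁ (x + P • e i) = U₁ x := datum_per hW hU₀per hU'per hu₁P
  have hdatP := datum_perz (η := η) hU₁P hdat
  have hAP : ∀ (z : Site d) (i : Fin d), perz P A (z + P • e i) = perz P A z := perz_per P A
  -- the datum's (1.69) on the bonds touching `T_η` at every `j ≤ m` from the level-`m` bound
  have hdat' : ∀ j, j ≤ m → ∀ b ∈ {b : Site d × Fin d | SideTouches ((fun _ => (Set.univ : Set (Site d))) j) b.1 b.2},
      U₁ b.1 b.2 = cfgExp η (perz P A) b.1 b.2 ∧ IsSelfAdjoint (perz P A b.1 b.2) ∧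
        ‖perz P A b.1 b.2‖ ≤ (5 * (d : ℝ) * L * B₀ * (α₀ + α₁)) * ((L : ℝ) ^ j * η)⁻¹ := by
    intro j hj b _
    obtain ⟨h1, h2, h3⟩ := hdatP b.1 b.2
    refine ⟨h1, h2, h3.trans (mul_le_mul_of_nonneg_left ?_ hcs0)⟩
    rw [mul_inv, mul_inv]
    refine mul_le_mul_of_nonneg_right ?_ (by positivity)
    exact inv_anti₀ (by positivity) (pow_le_pow_right₀ hLr hj)
  -- the periodic `τ`-free ∃λ-body at this datum, from the v3 letters
  have hbody := sockHFPτ_family_of_lettersAtPer τ hτ hd2 hL hη hGrp2 hGrp3 hGA hGH hGu hα₀ hα₁ hB₀ hB₀' hB₀'H hB₂' hBG hBR hU₀G hU'G h33 h34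
    hAx h135 hPdiv hU₀per ℓ ℓτ SB9all hwin m hm1 hmk u₁ U₁ (perz P A) hu₁G hu₁P hAP hW h129 hLan hdat'
  exact sockP5Step_body_per hd2 hη hL1 m τ hG3 hU₀ hα84 hcs12 hdatP hbody

/-- ★ **ROUTE P's PROPOSITION-5 BASE SOCKET (`u₁ = 1`, `U₁ = U′`, p. 89) FROM THE v3 LETTERS**: `B8Thm2TorusSupplier.SockP5Base L P η α₄ G U₀ U′` at
`α₄ = 8B₀′·5dLB₀·(α₀ + α₁)`, given the (1.36) exponent `A` of `U′` bondwise — the v3 twin of `B8Thm2TorusServerP3.sockP5Base_of_lettersAt_u` with the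
«exactly one» input replaced by the periodicity of the v3 ∃λ-body (`B8SockHFPTorusTraceFreePer.sockHFP₀τ_family_of_lettersAtPer` at `π A`, then
`sockP5Base_body_per`).  JOIN windows at `B_R + 2`. [cite: Balaban1985RegularSpaces, Prop. 5 (1.106)–(1.108) p.94, p.89 (the start of the induction), (1.36) p.82, p.77, p.76, §3 p.98] -/
theorem sockP5Base_of_lettersAtPer (hτ : ∀ x y : 𝔸, τ (x * y) = τ (y * x)) (hd2 : 2 ≤ d) {L : ℕ} (hL : 2 ≤ L) {η : ℝ} (hη : 0 < η)
    {k : ℕ} (hk : 1 ≤ k)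
    {G H : Subgroup 𝔸ˣ} (hGrp2 : ∀ g ∈ H, ‖(g : 𝔸) - 1‖ ≤ 1 / 8 → τ (mlog (g : 𝔸)) = 0) (hGrp3 : ∀ S : 𝔸, τ S = 0 → expUnit S ∈ H)
    (hGA : AvgClosed d L G) (hGH : G ≤ H) (hGu : G ≤ unitaryUnits 𝔸)
    (hG3 : ∀ (lam : Site d → 𝔸) (x : Site d), IsSelfAdjoint (lam x) → τ (lam x) = 0 → gaugeExp lam x ∈ G)
    {α₀ α₁ B₀ B₀' B₀'H B₂' BG BR B₀β cB9 cB β : ℝ} {len : Site d → ℝ} (hα₀ : 0 < α₀) (hα₁ : 0 < α₁)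
    (hB₀ : 0 < B₀) (hB₀' : 0 < B₀') (hB₀'H : 0 < B₀'H) (hB₂' : 0 ≤ B₂') (hBG : 0 ≤ BG) (hBR : 0 ≤ BR)
    {U₀ U' : Site d → Fin d → 𝔸ˣ} (hU₀G : ∀ x κ, U₀ x κ ∈ G) (hU'G : ∀ x κ, U' x κ ∈ G)
    (h33 : InAk L k η α₀ (fun _ => (Set.univ : Set (Site d))) U₀) (h34 : InAk L k η α₀ (fun _ => (Set.univ : Set (Site d))) (mulCfg U' U₀))
    (hAx : ∀ m', m' ≤ k → InAx L m' (torusLam (d := d) m') U₀ (mulCfg U' U₀))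
    -- the torus: the period `P = Lᵏ·M`, the pair periodic, the v3 [4] letters and their `τ`-add-on
    {P : ℤ} (hPdiv : ∃ M : ℤ, P = (L : ℤ) ^ k * M) (hU₀per : ∀ (z : Site d) (i : Fin d), U₀ (z + P • e i) = U₀ z)
    (hU'per : ∀ (z : Site d) (i : Fin d), U' (z + P • e i) = U' z)
    (ℓ : LettersAtPer (𝔸 := 𝔸) L BG BR B₀'H B₂' B₀ B₀β cB β len η k α₀ P U₀) (ℓτ : LettersPerTau (𝔸 := 𝔸) τ ℓ)
    (hwin : ∀ cs α₄ cB cDA hE hE₂ lE lE₂ : ℝ, cs = 5 * (d : ℝ) * L * B₀ * (α₀ + α₁) → α₄ = 8 * B₀' * (5 * (d : ℝ) * L * B₀) * (α₀ + α₁) →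
      cB = L * cs → cDA = 2 * (d : ℝ) * (L : ℝ) ^ 2 * cs →
      hE = B₀'H * (C2p d * (40 * d * cB + α₄) * α₄) → hE₂ = B₂' * (C2p d * (40 * d * cB + α₄) * α₄) →
      lE = B₀'H * (4 * C2p d * (40 * d * cB + 2 * α₄)) → lE₂ = B₂' * (4 * C2p d * (40 * d * cB + 2 * α₄)) →
      36 * d * B₀ * cs ≤ 1 / 2 ∧
      8 * (131072 * ((d : ℝ) + 1) ^ 2) * Real.exp (4 * (800 * ((d : ℝ) + 1) ^ 2 * ((d : ℝ) + 4)) * α₀) ≤ 16 * (131072 * ((d : ℝ) + 1) ^ 2) ∧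
      2 * cs ^ 2 + 20 * d * α₀ * cs + 2 * (16 * (131072 * ((d : ℝ) + 1) ^ 2)) * cs ^ 2 ≤ α₀ + α₁ ∧
      (d : ℝ) * L * α₁ ≤ 1 / 8 ∧
      α₀ ≤ cB9 ∧ cs ≤ cB9 ∧
      C0 d * α₀ ≤ 1 / 3 ∧ 4 * α₀ ≤ c2' d L ∧
      Real.exp (4 * (800 * ((d : ℝ) + 1) ^ 2 * ((d : ℝ) + 4)) * α₀) * (1 + 8 * (131072 * ((d : ℝ) + 1) ^ 2) * cB) ≤ 2 ∧
      2 * cB ≤ c3 d L ∧ 2048 * (d : ℝ) * cB ≤ 1 ∧ 40 * d * cB ≤ 1 / 200 ∧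
      200 * C6 d * (2 * α₄) ≤ 1 ∧ 12000 * ((d : ℝ) + 1) * L * (2 * α₄) ≤ 1 ∧
      C4G d L * (α₀ + 40 * d * cB + 4 * (2 * α₄)) ≤ 1 ∧
      1024 * ((d : ℝ) + 1) * ((d : ℝ) + 4) * L ^ 2 * α₀ ≤ 1 ∧ 32 * ((d : ℝ) + 1) ^ 2 * C6 d * L ^ 2 * α₀ ≤ 1 ∧
      16 * d * C5' d * C6 d * (L : ℝ) ^ 2 * α₀ ≤ 1 ∧ 8 * d * C6 d * L * α₀ ≤ 1 ∧
      40 * d * cB + α₄ ≤ 1 / (4 * B₀'H * (2 * C2p d)) ∧ 2 * C6 d * (40 * d * cB + 4 * α₄) ≤ 1 / 8 ∧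
      cB ≤ 1 / 13 ∧ α₄ / 4 + hE ≤ 1 / 24 ∧ α₄ / 4 + hE ≤ 1 / 140 ∧ 10 * (α₄ / 4 + hE) * (BR + 2) ≤ 1 / 2 ∧
      BG * Mc d (BR + 2) (α₄ / 4 + hE) cB hE₂ cDA ≤ α₄ / 4 ∧
      BG * Kc d (BR + 2) (α₄ / 4 + hE) cB hE₂ cDA lE₂ (1 + lE) (1 + lE) ≤ 1 / 2)
    {A : Site d → Fin d → 𝔸}
    (hdat : ∀ (x : Site d) (κ : Fin d), U' x κ = cfgExp η A x κ ∧ IsSelfAdjoint (A x κ) ∧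
      ‖A x κ‖ ≤ (5 * (d : ℝ) * L * B₀ * (α₀ + α₁)) * ((L : ℝ) ^ 0 * η)⁻¹) :
    SockP5Base (𝔸 := 𝔸) L P η (8 * B₀' * (5 * (d : ℝ) * L * B₀) * (α₀ + α₁)) G U₀ U' := by
  have hL1 : 1 ≤ L := le_trans (by norm_num) hL
  have hLr : (1 : ℝ) ≤ L := by exact_mod_cast hL1
  have hU₀ : ∀ x κ, U₀ x κ ∈ unitaryUnits 𝔸 := fun x κ => hGu (hU₀G x κ)
  -- two of the windows: `α₄ ≤ 1/84` and `c⋆ ≤ 1/12`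
  obtain ⟨-, -, -, -, -, -, -, -, -, -, -, hα₃', hs₁, -⟩ := hwin _ _ _ _ _ _ _ _ rfl rfl rfl rfl rfl rfl rfl rfl
  have hsum : 0 ≤ α₀ + α₁ := by linarith
  have hcs0 : 0 ≤ 5 * (d : ℝ) * L * B₀ * (α₀ + α₁) := by positivity
  have hC6 : (2 : ℝ) ≤ C6 d := by unfold C6; linarith [one_le_C5 (d := d)]
  have hα84 : 8 * B₀' * (5 * (d : ℝ) * L * B₀) * (α₀ + α₁) ≤ 1 / 84 := by
    have h0 : 0 ≤ 8 * B₀' * (5 * (d : ℝ) * L * B₀) * (α₀ + α₁) := by positivity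
    nlinarith [hs₁, hC6, h0]
  have hcs12 : 5 * (d : ℝ) * L * B₀ * (α₀ + α₁) ≤ 1 / 12 := by
    have hd0 : (1 : ℝ) ≤ d := by exact_mod_cast (show 1 ≤ d by omega)
    have hcsB : 5 * (d : ℝ) * L * B₀ * (α₀ + α₁) ≤ L * (5 * (d : ℝ) * L * B₀ * (α₀ + α₁)) := le_mul_of_one_le_left hcs0 hLr
    have hcBsmall : (d : ℝ) * (L * (5 * (d : ℝ) * L * B₀ * (α₀ + α₁))) ≤ 1 / 8000 := by linarith only [hα₃']
    have h1 : 5 * (d : ℝ) * L * B₀ * (α₀ + α₁) ≤ 1 / 8000 :=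
      ((le_mul_of_one_le_left hcs0 hd0).trans (mul_le_mul_of_nonneg_left hcsB (by positivity))).trans hcBsmall
    linarith only [h1]
  -- the periodised (1.36) exponent of the periodic `U′`
  have hdatP := datum_perz (η := η) hU'per hdat
  have hAP : ∀ (z : Site d) (i : Fin d), perz P A (z + P • e i) = perz P A z := perz_per P A
  have hdat' : ∀ j, j ≤ 0 → ∀ b ∈ {b : Site d × Fin d | SideTouches ((fun _ => (Set.univ : Set (Site d))) j) b.1 b.2},
      U' b.1 b.2 = cfgExp η (perz P A) b.1 b.2 ∧ IsSelfAdjoint (perz P A b.1 b.2) ∧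
        ‖perz P A b.1 b.2‖ ≤ (5 * (d : ℝ) * L * B₀ * (α₀ + α₁)) * ((L : ℝ) ^ j * η)⁻¹ := by
    intro j hj b _
    obtain rfl : j = 0 := Nat.le_zero.1 hj
    exact hdatP b.1 b.2
  -- the periodic `τ`-free ∃λ-body at the base datum, from the v3 letters
  have hbody := sockHFP₀τ_family_of_lettersAtPer τ hτ hd2 hL hη hk hGrp2 hGrp3 hGA hGH hGu hα₀ hα₁ hB₀ hB₀' hB₀'H hB₂' hBG hBR hU₀G hU'G h33
    h34 hAx hPdiv hU₀per ℓ ℓτ hwin (perz P A) hAP hdat'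
  exact sockP5Base_body_per hd2 hη hL1 (P := P) τ hG3 hU₀ hα84 hcs12 hdatP hbody

end Step

#print axioms QT_perzFam_eq
#print axioms exists_levelPeriodic_multiplier
#print axioms sockP5Step_body_per
#print axioms sockP5Base_body_per
#print axioms sockP5Step_of_lettersAtPer
#print axioms sockP5Base_of_lettersAtPer

end Literature.MathematicalPhysics.QuantumFieldTheory.Balaban1983to89.B8Thm2TorusServerPer

end
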